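import Summits.ValiantsHypothesis.ValiantsHypothesis.Theorems.SymPencilCyclicIsotropy
import Summits.ValiantsHypothesis.ValiantsHypothesis.Theorems.SymPencilKernelInvariance

/-!
# Route `SymPencil` — the AFFINE LEVER at a base point of the kernel space
# (tool file for the size-`27` cell `(10,6,6)` of `sdc(per_4)`, `--supports`
# stmt-ValiantsHypothesis-5674 `SdcSuperquadratic`; rung currency only, nothing here bears on
# `VP ≠ VNP`)

Setting: the base-point package of a symmetric affine determinantal representation of `per_4`
(`SymPencilPerFourBasePointPackage`): an invertible symmetric `D`, kernel rows `bL`, symmetric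
blocks `CL`, `κ ≠ 0`, the origin moments and, for every `v` with `bL v = 0`, invertibility of
`D_v := D + CL v` together with the pencil identity based at `v`.  Fix such a `v` along which `per_4`
is AFFINE (`per_4 (z + s v) = e₀ + s e₁` for every `z`; e.g. a one-row or one-column matrix), and
write `F_v z := per_4 (z + v) - per_4 z` for the linear coefficient, `u_v z := D_v⁻¹ bL z`,
`N_v y := CL v (D⁻¹ y)`, `B := im bL`.

* `inv_isotropic_of_affine`: `bL z ⬝ D_v⁻¹ bL z' = 0` (the square family vanishes, so
  `SymPencilBasePointFamily.basepoint_family` at `S = 0`, polarised).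
* `master_of_affine` (the MASTER identity of `Cruxes/SdcPerBeyondN/NEXT-RUNG-H7.md` (H7.1), now
  for an arbitrary kernel space): `det D_v · u_v(z)ᵀ CL(z) u_v(z) = κ · F_v z` for every `z`.
* `shift_invariance_of_affine` (the LEVER): whenever `u_v(x)` lies in the Lagrangian-type space
  `D⁻¹ B`, the cubic `F_v` is invariant under translation of `x` by the whole kernel space:
  `F_v (x + w) = F_v x` for all `w` with `bL w = 0` (the blocks `CL w` vanish on `D⁻¹B × D⁻¹B`).
* `two_mul_finrank_sup_le_of_affine`: `B + (1 + N_v) B` is `D⁻¹`-isotropic (cyclic isotropy,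
  `SymPencilCyclicIsotropy`), hence `2 dim (B ⊔ (1 + N_v) B) ≤ |ι'|`; and
  `four_mul_finrank_le_of_affine`: `4 dim B ≤ 2 dim (B ⊓ (1 + N_v) B) + |ι'|` — at size `27`
  (`|ι'| = 26`, `dim B = 10`) the space `B ∩ (1 + N_v) B` of kernel rows `y` with `u_v` in `D⁻¹ B`
  has dimension `≥ 7`, and on its preimage the lever applies.

For the cross space `V× = row 0 ⊕ K E₁₀ ⊕ K E₂₀` (the `V`-immortal candidate of the cell
`(10,6,6)`, `SymPencilPerFourSixDimJointSix`) the lever with `v ∈ row 0` forces that preimage to be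
`{x₃' = 0}` and starts the one-row endgame on it (`SymPencilPerFourCrossSix*`).  Pure bookkeeping
on top of the tree's base-point tools; no definitions, no named facts. [folklore]
-/

noncomputable section

-- single-conjunct layout: Sub = Summit, duplicated namespace component intended
set_option linter.dupNamespace false

namespace Summit.ValiantsHypothesis.ValiantsHypothesis.Theorems.SymPencilAffineKernelLever

open Matrix MvPolynomial Module
open Literature.Computability.AlgebraicComplexity
open Summit.ValiantsHypothesis.ValiantsHypothesis.Theorems.SymPencilLagrangianKernel
open Summit.ValiantsHypothesis.ValiantsHypothesis.Theorems.SymPencilBasePointFamily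
open Summit.ValiantsHypothesis.ValiantsHypothesis.Theorems.SymPencilCyclicIsotropy
open Summit.ValiantsHypothesis.ValiantsHypothesis.Theorems.SymPencilHomogeneousDropRankCodim

universe u

variable {k : Type u} [Field k] [CharZero k] {ι' : Type*} [Fintype ι'] [DecidableEq ι']

/-- **Isotropy at the base point**: along an affine kernel direction `v`, the kernel rows are
`(D + CL v)⁻¹`-isotropic (bilinear form). [folklore] -/
theorem inv_isotropic_of_affine {D : Matrix ι' ι' k} (hDs : Dᵀ = D)
    (bL : (Fin 4 × Fin 4 → k) →ₗ[k] (ι' → k)) (CL : (Fin 4 × Fin 4 → k) →ₗ[k] Matrix ι' ι' k)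
    (hCs : ∀ z, (CL z)ᵀ = CL z) {κ : k} (hκ : κ ≠ 0)
    (hN : ∀ v, bL v = 0 → IsUnit (D + CL v).det ∧ ∀ (z : Fin 4 × Fin 4 → k) (s : k),
      κ * MvPolynomial.eval (v + s • z) (perPoly (Fin 4) k) =
        (Matrix.fromBlocks ((s * 0) • (1 : Matrix Unit Unit k))
          (Matrix.replicateRow Unit (s • bL z)) (Matrix.replicateCol Unit (s • bL z))
          (D + CL v + s • CL z)).det)
    (v : Fin 4 × Fin 4 → k) (hv : bL v = 0)
    (haff : ∀ z, ∃ e₀ e₁ : k, ∀ s : k,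
      MvPolynomial.eval (z + s • v) (perPoly (Fin 4) k) = e₀ + s * e₁)
    (z z' : Fin 4 × Fin 4 → k) :
    bL z ⬝ᵥ (D + CL v)⁻¹ *ᵥ bL z' = 0 := by
  have hu : IsUnit (D + CL v).det := (hN v hv).1
  have hq : ∀ w : Fin 4 × Fin 4 → k, bL w ⬝ᵥ (D + CL v)⁻¹ *ᵥ bL w = 0 := by
    intro w
    obtain ⟨e₀, e₁, he⟩ := haff w
    have hexp : ∀ s : k, MvPolynomial.eval (w + s • v) (perPoly (Fin 4) k) =
        e₀ + s * e₁ + s ^ 2 * 0 := fun s => by rw [he]; ring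
    obtain ⟨h1, -⟩ := basepoint_family bL CL hN hκ v hv w e₀ e₁ 0 hexp
    rw [mul_zero, neg_zero] at h1
    exact (mul_eq_zero.1 h1).resolve_left hu.ne_zero
  have hsym : ((D + CL v)⁻¹)ᵀ = (D + CL v)⁻¹ := by
    rw [Matrix.transpose_nonsing_inv, Matrix.transpose_add, hDs, hCs]
  have h1 := hq (z + z')
  rw [map_add, Matrix.mulVec_add, dotProduct_add, add_dotProduct, add_dotProduct, hq z, hq z',
    dotProduct_mulVec_of_transpose_eq hsym (bL z'), dotProduct_comm (_ *ᵥ bL z'), zero_add,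
    add_zero, ← two_mul] at h1
  exact (mul_eq_zero.1 h1).resolve_left two_ne_zero

omit [CharZero k] [Fintype ι'] [DecidableEq ι'] in
/-- The linear coefficient of an affine restriction: if `per_4 (z + s v) = e₀ + s e₁` for all `s`,
then `e₀ = per_4 z` and `e₁ = per_4 (z + v) - per_4 z`. [folklore] -/
theorem affine_coeffs {v z : Fin 4 × Fin 4 → k} {e₀ e₁ : k}
    (he : ∀ s : k, MvPolynomial.eval (z + s • v) (perPoly (Fin 4) k) = e₀ + s * e₁) :
    e₀ = MvPolynomial.eval z (perPoly (Fin 4) k) ∧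
      e₁ = MvPolynomial.eval (z + v) (perPoly (Fin 4) k) - MvPolynomial.eval z (perPoly (Fin 4) k) := by
  have h0 := he 0
  have h1 := he 1
  rw [zero_smul, add_zero, zero_mul, add_zero] at h0
  rw [one_smul, one_mul] at h1
  exact ⟨h0.symm, by rw [h1, h0]; ring⟩

/-- **MASTER identity at an affine base point** (`Cruxes/SdcPerBeyondN/NEXT-RUNG-H7.md` (H7.1),
for an arbitrary kernel space): with `u = (D + CL v)⁻¹ bL z`,
`det (D + CL v) · uᵀ CL(z) u = κ · (per_4 (z + v) - per_4 z)`. [folklore] -/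
theorem master_of_affine {D : Matrix ι' ι' k} (hDs : Dᵀ = D)
    (bL : (Fin 4 × Fin 4 → k) →ₗ[k] (ι' → k)) (CL : (Fin 4 × Fin 4 → k) →ₗ[k] Matrix ι' ι' k)
    (hCs : ∀ z, (CL z)ᵀ = CL z) {κ : k} (hκ : κ ≠ 0)
    (hN : ∀ v, bL v = 0 → IsUnit (D + CL v).det ∧ ∀ (z : Fin 4 × Fin 4 → k) (s : k),
      κ * MvPolynomial.eval (v + s • z) (perPoly (Fin 4) k) =
        (Matrix.fromBlocks ((s * 0) • (1 : Matrix Unit Unit k))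
          (Matrix.replicateRow Unit (s • bL z)) (Matrix.replicateCol Unit (s • bL z))
          (D + CL v + s • CL z)).det)
    (v : Fin 4 × Fin 4 → k) (hv : bL v = 0)
    (haff : ∀ z, ∃ e₀ e₁ : k, ∀ s : k,
      MvPolynomial.eval (z + s • v) (perPoly (Fin 4) k) = e₀ + s * e₁)
    (z : Fin 4 × Fin 4 → k) :
    (D + CL v).det * (((D + CL v)⁻¹ *ᵥ bL z) ⬝ᵥ CL z *ᵥ ((D + CL v)⁻¹ *ᵥ bL z)) =
      κ * (MvPolynomial.eval (z + v) (perPoly (Fin 4) k) - MvPolynomial.eval z (perPoly (Fin 4) k)) := by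
  obtain ⟨e₀, e₁, he⟩ := haff z
  have hexp : ∀ s : k, MvPolynomial.eval (z + s • v) (perPoly (Fin 4) k) =
      e₀ + s * e₁ + s ^ 2 * 0 := fun s => by rw [he]; ring
  obtain ⟨-, d₁, d₂, h3, -⟩ := basepoint_family bL CL hN hκ v hv z e₀ e₁ 0 hexp
  have hiso := inv_isotropic_of_affine hDs bL CL hCs hκ hN v hv haff z z
  rw [hiso, mul_zero, zero_sub, mul_neg, neg_inj] at h3
  have hsym : ((D + CL v)⁻¹)ᵀ = (D + CL v)⁻¹ := by
    rw [Matrix.transpose_nonsing_inv, Matrix.transpose_add, hDs, hCs]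
  rw [sandwich₂_eq hsym] at h3
  rw [h3, (affine_coeffs he).2]

omit [CharZero k] in
/-- The blocks `CL w` of a kernel direction `w` vanish on `D⁻¹ (im bL) × D⁻¹ (im bL)`
(polarised first origin moment). [folklore] -/
theorem block_vanish_on_lagrangian {D : Matrix ι' ι' k} (hDs : Dᵀ = D)
    (bL : (Fin 4 × Fin 4 → k) →ₗ[k] (ι' → k)) (CL : (Fin 4 × Fin 4 → k) →ₗ[k] Matrix ι' ι' k)
    (hii : ∀ z, bL z ⬝ᵥ (D⁻¹ * CL z * D⁻¹) *ᵥ bL z = 0)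
    (w : Fin 4 × Fin 4 → k) (hw : bL w = 0) (z₀ : Fin 4 × Fin 4 → k) :
    (D⁻¹ *ᵥ bL z₀) ⬝ᵥ CL w *ᵥ (D⁻¹ *ᵥ bL z₀) = 0 := by
  have hDis : (D⁻¹)ᵀ = D⁻¹ := by rw [Matrix.transpose_nonsing_inv, hDs]
  have h1 := hii (z₀ + w)
  have h0 := hii z₀
  rw [map_add, hw, add_zero, map_add, sandwich₂_eq hDis, Matrix.add_mulVec, dotProduct_add] at h1
  rw [sandwich₂_eq hDis] at h0
  rwa [h0, zero_add] at h1

/-- **The affine lever.**  If `u_v(x) = (D + CL v)⁻¹ bL x` lies in `D⁻¹ (im bL)`, then the cubic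
`F_v = per_4 (· + v) - per_4` is invariant at `x` under translation by every kernel direction:
`F_v (x + w) = F_v x` whenever `bL w = 0`. [folklore] -/
theorem shift_invariance_of_affine {D : Matrix ι' ι' k} (hDs : Dᵀ = D)
    (bL : (Fin 4 × Fin 4 → k) →ₗ[k] (ι' → k)) (CL : (Fin 4 × Fin 4 → k) →ₗ[k] Matrix ι' ι' k)
    (hCs : ∀ z, (CL z)ᵀ = CL z) {κ : k} (hκ : κ ≠ 0)
    (hii : ∀ z, bL z ⬝ᵥ (D⁻¹ * CL z * D⁻¹) *ᵥ bL z = 0)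
    (hN : ∀ v, bL v = 0 → IsUnit (D + CL v).det ∧ ∀ (z : Fin 4 × Fin 4 → k) (s : k),
      κ * MvPolynomial.eval (v + s • z) (perPoly (Fin 4) k) =
        (Matrix.fromBlocks ((s * 0) • (1 : Matrix Unit Unit k))
          (Matrix.replicateRow Unit (s • bL z)) (Matrix.replicateCol Unit (s • bL z))
          (D + CL v + s • CL z)).det)
    (v : Fin 4 × Fin 4 → k) (hv : bL v = 0)
    (haff : ∀ z, ∃ e₀ e₁ : k, ∀ s : k,
      MvPolynomial.eval (z + s • v) (perPoly (Fin 4) k) = e₀ + s * e₁)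
    (x : Fin 4 × Fin 4 → k) (z₀ : Fin 4 × Fin 4 → k) (hx : (D + CL v)⁻¹ *ᵥ bL x = D⁻¹ *ᵥ bL z₀)
    (w : Fin 4 × Fin 4 → k) (hw : bL w = 0) :
    MvPolynomial.eval (x + w + v) (perPoly (Fin 4) k) - MvPolynomial.eval (x + w) (perPoly (Fin 4) k) =
      MvPolynomial.eval (x + v) (perPoly (Fin 4) k) - MvPolynomial.eval x (perPoly (Fin 4) k) := by
  have hu : IsUnit (D + CL v).det := (hN v hv).1
  have h1 := master_of_affine hDs bL CL hCs hκ hN v hv haff (x + w)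
  have h0 := master_of_affine hDs bL CL hCs hκ hN v hv haff x
  have hbx : bL (x + w) = bL x := by rw [map_add, hw, add_zero]
  rw [hbx, hx, map_add, Matrix.add_mulVec, dotProduct_add,
    block_vanish_on_lagrangian hDs bL CL hii w hw z₀, add_zero] at h1
  rw [hx] at h0
  have h := h1.symm.trans h0
  exact mul_left_cancel₀ hκ h

/-- **Dimension of the lever space.**  Along an affine kernel direction `v`, the space
`im bL + (D + CL v) D⁻¹ (im bL)` is `D⁻¹`-isotropic, so twice its dimension is at most `|ι'|`.
[folklore] -/
theorem two_mul_finrank_sup_le_of_affine {D : Matrix ι' ι' k} (hD : IsUnit D.det) (hDs : Dᵀ = D)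
    (bL : (Fin 4 × Fin 4 → k) →ₗ[k] (ι' → k)) (CL : (Fin 4 × Fin 4 → k) →ₗ[k] Matrix ι' ι' k)
    (hCs : ∀ z, (CL z)ᵀ = CL z) {κ : k} (hκ : κ ≠ 0)
    (hN : ∀ v, bL v = 0 → IsUnit (D + CL v).det ∧ ∀ (z : Fin 4 × Fin 4 → k) (s : k),
      κ * MvPolynomial.eval (v + s • z) (perPoly (Fin 4) k) =
        (Matrix.fromBlocks ((s * 0) • (1 : Matrix Unit Unit k))
          (Matrix.replicateRow Unit (s • bL z)) (Matrix.replicateCol Unit (s • bL z))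
          (D + CL v + s • CL z)).det)
    (v : Fin 4 × Fin 4 → k) (hv : bL v = 0)
    (haff : ∀ z, ∃ e₀ e₁ : k, ∀ s : k,
      MvPolynomial.eval (z + s • v) (perPoly (Fin 4) k) = e₀ + s * e₁) :
    2 * finrank k (LinearMap.range bL ⊔
        (LinearMap.range bL).map ((D + CL v) * D⁻¹).mulVecLin : Submodule k (ι' → k)) ≤
      Fintype.card ι' := by
  classical
  have hDis : (D⁻¹)ᵀ = D⁻¹ := by rw [Matrix.transpose_nonsing_inv, hDs]
  have hDiu : IsUnit D⁻¹ :=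
    (Matrix.isUnit_iff_isUnit_det _).2 (Matrix.isUnit_nonsing_inv_det_iff.2 hD)
  -- cyclic isotropy at orders 0, 1, 2, as bilinear identities on the kernel rows
  have hc := fun (z z' : Fin 4 × Fin 4 → k) (n : ℕ) =>
    cyclic_isotropy_of_affine hD hDs bL CL hCs hκ hN v hv haff z z' n
  have h0 : ∀ z z', bL z ⬝ᵥ D⁻¹ *ᵥ bL z' = 0 := fun z z' => by
    have h := hc z z' 0
    rwa [pow_zero, one_mul] at h
  have h1 : ∀ z z', bL z ⬝ᵥ D⁻¹ *ᵥ (CL v *ᵥ (D⁻¹ *ᵥ bL z')) = 0 := fun z z' => by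
    have h := hc z z' 1
    rwa [pow_one, ← Matrix.mulVec_mulVec, ← Matrix.mulVec_mulVec] at h
  have h2 : ∀ z z', (CL v *ᵥ (D⁻¹ *ᵥ bL z)) ⬝ᵥ D⁻¹ *ᵥ (CL v *ᵥ (D⁻¹ *ᵥ bL z')) = 0 := by
    intro z z'
    have h := hc z z' 2
    rw [pow_two, Matrix.mul_assoc (D⁻¹ * CL v), Matrix.mul_assoc D⁻¹ (CL v),
      ← Matrix.mulVec_mulVec, ← Matrix.mulVec_mulVec, dotProduct_mulVec_of_transpose_eq hDis,
      dotProduct_mulVec_of_transpose_eq (hCs v), ← Matrix.mulVec_mulVec, ← Matrix.mulVec_mulVec] at h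
    exact h
  -- the translate `T y = y + CL v (D⁻¹ y)`
  have hT : ∀ y : ι' → k, ((D + CL v) * D⁻¹).mulVecLin y = y + CL v *ᵥ (D⁻¹ *ᵥ y) := by
    intro y
    rw [Matrix.mulVecLin_apply, Matrix.add_mul, Matrix.mul_nonsing_inv _ hD, Matrix.add_mulVec,
      Matrix.one_mulVec, Matrix.mulVec_mulVec]
  set U := LinearMap.range bL ⊔ (LinearMap.range bL).map ((D + CL v) * D⁻¹).mulVecLin with hU
  have hiso : ∀ x ∈ U, x ⬝ᵥ D⁻¹ *ᵥ x = 0 := by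
    intro x hx
    rw [hU, Submodule.mem_sup] at hx
    obtain ⟨_, ⟨z, rfl⟩, _, ⟨_, ⟨z', rfl⟩, rfl⟩, rfl⟩ := hx
    rw [hT]
    have e00 := h0 z z
    have e01 := h0 z z'
    have e10 := h0 z' z
    have e11 := h0 z' z'
    have f01 := h1 z z'
    have f11 := h1 z' z'
    have g11 := h2 z' z'
    -- `(CL v D⁻¹ y') ⬝ D⁻¹ y = y ⬝ D⁻¹ (CL v D⁻¹ y')`
    have hsw : ∀ a b : ι' → k, a ⬝ᵥ D⁻¹ *ᵥ b = b ⬝ᵥ D⁻¹ *ᵥ a := fun a b => by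
      rw [dotProduct_mulVec_of_transpose_eq hDis, dotProduct_comm]
    simp only [Matrix.mulVec_add, dotProduct_add, add_dotProduct]
    rw [hsw (CL v *ᵥ (D⁻¹ *ᵥ bL z')) (bL z), hsw (CL v *ᵥ (D⁻¹ *ᵥ bL z')) (bL z'),
      e00, e01, e10, e11, f01, f11, g11]
    ring
  have h := rank_add_two_mul_finrank_le_of_quadratic_form_eq_zero hDis U hiso
  rw [Matrix.rank_of_isUnit _ hDiu] at h
  omega

/-- **The lever space has dimension `≥ 2 dim B - |ι'|/2`**:
`4 dim (im bL) ≤ 2 dim (im bL ⊓ (D + CL v) D⁻¹ (im bL)) + |ι'|`.  At size `27` with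
`dim (im bL) = 10`: the intersection has dimension `≥ 7`. [folklore] -/
theorem four_mul_finrank_le_of_affine {D : Matrix ι' ι' k} (hD : IsUnit D.det) (hDs : Dᵀ = D)
    (bL : (Fin 4 × Fin 4 → k) →ₗ[k] (ι' → k)) (CL : (Fin 4 × Fin 4 → k) →ₗ[k] Matrix ι' ι' k)
    (hCs : ∀ z, (CL z)ᵀ = CL z) {κ : k} (hκ : κ ≠ 0)
    (hN : ∀ v, bL v = 0 → IsUnit (D + CL v).det ∧ ∀ (z : Fin 4 × Fin 4 → k) (s : k),
      κ * MvPolynomial.eval (v + s • z) (perPoly (Fin 4) k) =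
        (Matrix.fromBlocks ((s * 0) • (1 : Matrix Unit Unit k))
          (Matrix.replicateRow Unit (s • bL z)) (Matrix.replicateCol Unit (s • bL z))
          (D + CL v + s • CL z)).det)
    (v : Fin 4 × Fin 4 → k) (hv : bL v = 0)
    (haff : ∀ z, ∃ e₀ e₁ : k, ∀ s : k,
      MvPolynomial.eval (z + s • v) (perPoly (Fin 4) k) = e₀ + s * e₁) :
    4 * finrank k (LinearMap.range bL) ≤
      2 * finrank k (LinearMap.range bL ⊓
        (LinearMap.range bL).map ((D + CL v) * D⁻¹).mulVecLin : Submodule k (ι' → k)) +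
        Fintype.card ι' := by
  have hsup := two_mul_finrank_sup_le_of_affine hD hDs bL CL hCs hκ hN v hv haff
  have hTu : IsUnit ((D + CL v) * D⁻¹) := by
    rw [Matrix.isUnit_iff_isUnit_det, Matrix.det_mul]
    exact ((hN v hv).1).mul (Matrix.isUnit_nonsing_inv_det_iff.2 hD)
  have hinj : Function.Injective ((D + CL v) * D⁻¹).mulVecLin :=
    Matrix.mulVec_injective_iff_isUnit.2 hTu
  have hmap : finrank k ((LinearMap.range bL).map ((D + CL v) * D⁻¹).mulVecLin) =
      finrank k (LinearMap.range bL) :=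
    (Submodule.equivMapOfInjective _ hinj _).finrank_eq.symm
  have h := Submodule.finrank_sup_add_finrank_inf_eq (LinearMap.range bL)
    ((LinearMap.range bL).map ((D + CL v) * D⁻¹).mulVecLin)
  rw [hmap] at h
  omega

end Summit.ValiantsHypothesis.ValiantsHypothesis.Theorems.SymPencilAffineKernelLever

end
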